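import Summits.Ventures.YMGap.RobustBall.MassGapOnBall
import Summits.Ventures.YMGap.RobustBall.Defs
import HarnessLib

/-!
# Venture YMGap, track ROBUST-BALL (Y2) — crux Y2-X2-Zd, step 2: the GAUGE-INVARIANT tier-1 `ℤ^d` ball
# `MemBallZdG` and its target `MassGapOnBallZdG` (definitions)

HONEST FRAMING. WHAT THIS IS: a venture file (cell `pub-ymgap`, track Y2 ROBUST-BALL, seat ds-2):
DEFINITIONS and one-line comparison theorems only. The robust vertex-star door (Lemma G's mechanism:
gauge average at the centre of a star and freezing of a star link) needs every interaction term to be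
GAUGE INVARIANT, which rb-p1's tier-1 `ℤ^d` ball `MemBallZd` does not ask. This file types the sub-ball on
which the star door runs:
* `MemBallZdG ε₀ ε₁ R W supp` — `MemBallZd`-type regularity (continuous terms depending only on their own
  links, locally finite support family `supp`, `ℓ^∞` range `R : ℕ`), PLUS `IsZdGaugeInvariant (W X)` for
  every term, PLUS the loads of the TORUS ball of record `ClusterDomainFR` read on `ℤ^d`: oscillation load
  `Σ_{X ∈ supp{e}, e ∈ X} osc X e ≤ ε₀` at every link, and the SITE-INCIDENCE Lipschitz load
  `Σ_{X listed with a link based at v} Σ_{y ∈ X} lip X y ≤ ε₁` at every site `v` (self + cross, exactly as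
  `LoadWitness.selfLipLoad + crossLipLoad` charge a polymer to every link based at one of its sites);
* `MassGapOnBallZdG d N β ε₀ ε₁ R := ∀ members, PerturbedMassGapAt d N β W supp` (rb-p1's `ℤ^d` currency:
  unique DLR state + Shen–Zhu–Zhu clustering);
* comparisons: `MemBallZdG.memBallZd` (the G-ball is a SUB-BALL of rb-p1's `MemBallZd ε₀ ε₁ R`, so every
  landed `MassGapOnBallZd` row holds on it: `massGapOnBallZdG_of_massGapOnBallZd`), the centre
  `memBallZdG_zero`, and `MassGapOnBallZdG.massGapAt` (the ball theorem contains the Wilson theorem).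
WHAT THIS IS NOT: no door, no row, no number; nothing about the continuum or the Millennium problem.

## References
* rb-theory, `HOME/rb/ROBUST-BALL-DESIGN.md` §2.1 (loads), §3.2 (the `ℤ^d` object); rb-p1
  `RobustBall/MassGapOnBall.lean` (`MemBallZd`, `PerturbedMassGapAt`, followed field by field).
* E. Seiler, LNP 159 (1982) Ch. 2 (gauge-invariant lattice actions); H.-O. Georgii (2011) Def. 2.9.
-/

noncomputable section

open MeasureTheory Function Finset
open scoped NNReal
open Literature.Probability.LatticeModels
open Literature.Probability.LatticeModels.DobrushinMetric
open Literature.MathematicalPhysics.QuantumLattice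
open Literature.MathematicalPhysics.QuantumFieldTheory hiding ZdEdge

namespace Summit.Ventures.YMGap.RobustBall

variable {d N : ℕ}

/-! ### Site incidence on `ℤ^d` -/

/-- **The listed interaction sets with a link based at the site `v`** (site incidence, the `ℤ^d` reading
of the torus index set `polymersThroughEdge e = {X ∋ e.1}`): the sets listed at some link `(v, μ)` and
containing it. [folklore] -/
def listedAt (supp : Finset (ZdEdge d) → Finset (Finset (ZdEdge d))) (v : Site d) :
    Finset (Finset (ZdEdge d)) :=
  (Finset.univ : Finset (Fin d)).biUnion fun μ => (supp {((v, μ) : ZdEdge d)}).filter fun X =>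
    ((v, μ) : ZdEdge d) ∈ X

/-- Membership in `listedAt`. [folklore] -/
theorem mem_listedAt {supp : Finset (ZdEdge d) → Finset (Finset (ZdEdge d))} {v : Site d}
    {X : Finset (ZdEdge d)} :
    X ∈ listedAt supp v ↔ ∃ μ : Fin d, X ∈ supp {((v, μ) : ZdEdge d)} ∧ ((v, μ) : ZdEdge d) ∈ X := by
  simp [listedAt]

/-- The sets listed at `e` and containing `e` are listed at the site `e.1`. [folklore] -/
theorem filter_supp_subset_listedAt (supp : Finset (ZdEdge d) → Finset (Finset (ZdEdge d))) (e : ZdEdge d) :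
    (supp {e}).filter (fun X => e ∈ X) ⊆ listedAt supp e.1 := fun X hX => by
  obtain ⟨h1, h2⟩ := Finset.mem_filter.1 hX
  exact mem_listedAt.2 ⟨e.2, h1, h2⟩

/-- An active term (`W X ≠ 0`) of a supported potential through the link `e` is listed at the site `e.1`. [folklore] -/
theorem mem_listedAt_of_ne_zero {W : Potential (ZdEdge d) (SUN N)}
    {supp : Finset (ZdEdge d) → Finset (Finset (ZdEdge d))} (hsupp : W.IsSupportedBy supp)
    {X : Finset (ZdEdge d)} (hX : W X ≠ 0) {e : ZdEdge d} (he : e ∈ X) : X ∈ listedAt supp e.1 := by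
  classical
  refine filter_supp_subset_listedAt supp e (Finset.mem_filter.2 ⟨?_, he⟩)
  exact hsupp {e} X ⟨e, Finset.mem_inter.2 ⟨he, Finset.mem_singleton_self e⟩⟩ hX

/-! ### The gauge-invariant tier-1 `ℤ^d` ball -/

/-- **Membership of `(W, supp)` in the GAUGE-INVARIANT tier-1 `ℤ^d` ball of radii `(ε₀, ε₁)` and range
`R`**: the terms of the link potential `W` are continuous, depend only on their own links and are invariant
under every lattice gauge transformation of `ℤ^d` (`IsZdGaugeInvariant`); `W` is locally finitely supported
by `supp` with every listed set through a link `e` within `ℓ^∞`-distance `R` of `e`; and there are per-link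
oscillation witnesses `osc` (tree `Dobrushin.IsOscBound`) and Frobenius-Lipschitz witnesses `lip` (tree
`IsLipBound suFrobDist`) with OSCILLATION LOAD `Σ_{X ∈ supp{e}, e ∈ X} osc X e ≤ ε₀` at every link `e` and
SITE-INCIDENCE LIPSCHITZ LOAD `Σ_{X ∈ listedAt supp v} Σ_{y ∈ X} lip X y ≤ ε₁` at every site `v` — the
loads of the torus ball of record `ClusterDomainFR ε₀ ε₁ R` (`oscLoad`, `selfLipLoad + crossLipLoad`, site
incidence) read on `ℤ^d`. [folklore] -/
structure MemBallZdG (ε₀ ε₁ : ℝ) (R : ℕ) (W : Potential (ZdEdge d) (SUN N))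
    (supp : Finset (ZdEdge d) → Finset (Finset (ZdEdge d))) : Prop where
  /-- every term is continuous -/
  continuous : ∀ X, Continuous (W X)
  /-- every term depends only on the links of its set -/
  dependsOn : ∀ X, DependsOn (W X) (↑X : Set (ZdEdge d))
  /-- local finiteness: the active sets meeting a volume are listed -/
  supportedBy : W.IsSupportedBy supp
  /-- range: listed sets through `e` stay within `ℓ^∞`-distance `R` of `e` -/
  range : ∀ e, ∀ X ∈ supp {e}, e ∈ X → ∀ y ∈ X, ‖e.1 - y.1‖ ≤ (R : ℝ)
  /-- every term is gauge invariant -/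
  gaugeInvariant : ∀ X, IsZdGaugeInvariant (W X)
  /-- the per-link oscillation load and the per-site Lipschitz load -/
  loads : ∃ osc lip : Finset (ZdEdge d) → ZdEdge d → ℝ,
    (∀ X, Dobrushin.IsOscBound (W X) (osc X)) ∧ (∀ X, IsLipBound suFrobDist (W X) (lip X)) ∧
      (∀ e, ∑ X ∈ (supp {e}).filter (fun X => e ∈ X), osc X e ≤ ε₀) ∧
      (∀ v : Site d, ∑ X ∈ listedAt supp v, ∑ y ∈ X, lip X y ≤ ε₁)

/-- The zero potential with the empty support family is a member of every gauge-invariant ball with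
nonnegative radii — the centre of the ball is the Wilson action. [folklore] -/
theorem memBallZdG_zero {ε₀ ε₁ : ℝ} (h₀ : 0 ≤ ε₀) (h₁ : 0 ≤ ε₁) (R : ℕ) :
    MemBallZdG (N := N) ε₀ ε₁ R 0 (fun _ => (∅ : Finset (Finset (ZdEdge d)))) where
  continuous _ := continuous_const
  dependsOn _ _ _ _ := rfl
  supportedBy _ _ _ h := (h rfl).elim
  range _ _ h := by simp at h
  gaugeInvariant _ _ _ := rfl
  loads := ⟨fun _ _ => 0, fun _ _ => 0, fun _ => ⟨fun _ => le_rfl, fun _ _ _ _ => by simp⟩,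
    fun _ => ⟨fun _ => le_rfl, fun _ _ _ _ => by simp⟩, fun _ => by simpa using h₀,
    fun _ => by simp [listedAt]; exact h₁⟩

/-- **The gauge-invariant ball is a sub-ball of rb-p1's tier-1 `ℤ^d` ball** `MemBallZd ε₀ ε₁ R`: the
oscillation load is the same, and the cross-Lipschitz load of `MemBallZd` at `e` (sum over
`y ∈ perturbedNbr supp e` of the listed sets through `e`) is dominated by the site-incidence Lipschitz
load at `e.1` once the Lipschitz witnesses are cut down to the links of their sets
(`IsLipBound.restrict`). [folklore] -/
theorem MemBallZdG.memBallZd {ε₀ ε₁ : ℝ} {R : ℕ} {W : Potential (ZdEdge d) (SUN N)}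
    {supp : Finset (ZdEdge d) → Finset (Finset (ZdEdge d))} (h : MemBallZdG ε₀ ε₁ R W supp) :
    MemBallZd ε₀ ε₁ R W supp := by
  classical
  obtain ⟨osc, lip, hosc, hlip, hε₀, hε₁⟩ := h.loads
  refine ⟨h.continuous, h.dependsOn, h.supportedBy, h.range, osc,
    fun X y => if y ∈ X then lip X y else 0, hosc, fun X => (hlip X).restrict (h.dependsOn X), hε₀,
    fun e => ?_⟩
  rw [Finset.sum_comm]
  calc ∑ X ∈ (supp {e}).filter (fun X => e ∈ X), ∑ y ∈ perturbedNbr supp e, (if y ∈ X then lip X y else 0)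
      ≤ ∑ X ∈ (supp {e}).filter (fun X => e ∈ X), ∑ y ∈ X, lip X y := by
        refine Finset.sum_le_sum fun X _ => ?_
        rw [← Finset.sum_filter]
        exact Finset.sum_le_sum_of_subset_of_nonneg (fun y hy => (Finset.mem_filter.1 hy).2)
          fun y _ _ => (hlip X).nonneg y
    _ ≤ ∑ X ∈ listedAt supp e.1, ∑ y ∈ X, lip X y :=
        Finset.sum_le_sum_of_subset_of_nonneg (filter_supp_subset_listedAt supp e)
          fun X _ _ => Finset.sum_nonneg fun y _ => (hlip X).nonneg y
    _ ≤ ε₁ := hε₁ e.1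

/-! ### The target on the gauge-invariant ball -/

variable (d N) in
/-- **MASS GAP UNIFORMLY ON THE GAUGE-INVARIANT `ℤ^d` BALL**: every member `(W, supp)` of
`MemBallZdG ε₀ ε₁ R` has the mass gap `PerturbedMassGapAt d N β W supp` (unique DLR state + Shen–Zhu–Zhu
exponential clustering) at 't Hooft coupling `β`. Nothing is asserted by the definition. [folklore] -/
def MassGapOnBallZdG (β ε₀ ε₁ : ℝ) (R : ℕ) : Prop :=
  ∀ (W : Potential (ZdEdge d) (SUN N)) (supp : Finset (ZdEdge d) → Finset (Finset (ZdEdge d))),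
    MemBallZdG ε₀ ε₁ R W supp → PerturbedMassGapAt d N β W supp

/-- Every landed `MassGapOnBallZd` row (rb-p1's ball, single-link / pair doors) holds on the
gauge-invariant ball with the same radii. [folklore] -/
theorem massGapOnBallZdG_of_massGapOnBallZd {β ε₀ ε₁ : ℝ} {R : ℕ} (h : MassGapOnBallZd d N β ε₀ ε₁ R) :
    MassGapOnBallZdG d N β ε₀ ε₁ R := fun W supp hW => h W supp hW.memBallZd

/-- The ball theorem contains the Wilson theorem: `MassGapOnBallZdG d N β ε₀ ε₁ R → MassGapAt d N β`
(`0 ≤ ε₀, ε₁`; the zero member with the empty support family). [folklore] -/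
theorem MassGapOnBallZdG.massGapAt {β ε₀ ε₁ : ℝ} {R : ℕ} (h : MassGapOnBallZdG d N β ε₀ ε₁ R)
    (h₀ : 0 ≤ ε₀) (h₁ : 0 ≤ ε₁) : MassGapAt d N β :=
  (perturbedMassGapAt_zero_iff β fun _ => ∅).1 (h 0 _ (memBallZdG_zero h₀ h₁ R))

/-- Monotonicity of the target in the radii: a larger ball's theorem implies a smaller ball's. [folklore] -/
theorem MassGapOnBallZdG.mono {β ε₀ ε₁ ε₀' ε₁' : ℝ} {R R' : ℕ} (h : MassGapOnBallZdG d N β ε₀ ε₁ R)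
    (h₀ : ε₀' ≤ ε₀) (h₁ : ε₁' ≤ ε₁) (hR : R' ≤ R) : MassGapOnBallZdG d N β ε₀' ε₁' R' := by
  intro W supp hW
  obtain ⟨osc, lip, hosc, hlip, hε₀, hε₁⟩ := hW.loads
  refine h W supp ⟨hW.continuous, hW.dependsOn, hW.supportedBy, fun e X hX heX y hy =>
    (hW.range e X hX heX y hy).trans (by exact_mod_cast hR), hW.gaugeInvariant, osc, lip, hosc, hlip,
    fun e => (hε₀ e).trans h₀, fun v => (hε₁ v).trans h₁⟩

end Summit.Ventures.YMGap.RobustBall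

end
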